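import Summits.QuantumFields.BalabanUV.T4Continuum.Support.NE7HintOfLocalChartWide
import Summits.QuantumFields.BalabanUV.T4Continuum.Support.NE7AxialChartTorus
import HarnessLib

/-!
# NE7 — (8)∃ FROM THE PLAQUETTE-GRADIENT REGULARITY DATUM (PG), every dimension `d + 1` and block factor `L ≥ 2` (F292): THE CHART of row NE7
# DISCHARGED into axial-gauge kinematics (F288–F290) plus the covariant plaquette-gradient radius of the tangent-critical configuration
# ([Balaban1985Variational] Thm 1 (9)–(10) TYPE) — the generic companion of F291 `NE7HintOfPlaqGradSU2`

Cell `pub-balaban`, rung (B)+1 sub-cell t4, lineage `b2b-balaban-t4-ne7-p1` (CRUX PROVER NE7 #1 = OWNER of row NE7), generation 91; memo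
`t4/b2b-balaban-t4-ne7-p1-g91/COVER-OBSTRUCTION.md` §2–§4.  Over F285w `NE7HintOfLocalChartWide.hint_of_localChart_wide` and F290b
`NE7AxialChartTorus.exists_periodic_chart`.

WHAT ([folklore] composition + closed-form arithmetic; 0 def, 0 sorry).  §1 the letters in closed form (`Λ = nbRad (d+1) L + 2ℓ + 12`): `M·a₀ ≤ 4(d+1)Λ·t`,
`M²·a₁ ≤ [(4∕3)(2(d+1)ΛC_g + 16(d+1)²Λ² + 2) + 4(d+1)Λ]·t`.  §2 **`chart_of_plaqGrad`**: the `hchart` binder of F285w from (PG), for every cover factor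
`Kc ≥ 2·nbRad (d+1) L + 4ℓ + 24`, `0 ≤ ε ≤ 1∕(4(d+1)Λ)`, `β ≥ 0`, `C_g ≥ 0` (axial gauge about `z` on the cube of radius `(nbRad + 2ℓ + 11)M`, collar `M`,
periodised).  §3 **`hint_of_plaqGrad`**: F285w with `hchart` REPLACED by (PG) on the `(2·nbRad + 4ℓ + 24)`-fold cover: ∀ `C_g ≥ 0` ∃ `ℓ ≥ 1`, `ε₀ > 0`, ∀
`0 < ε ≤ ε₀` ∃ `β₀ > 0` ∀ `0 < β ≤ β₀` ∀ `N ≥ 1`: `LevelSmall` ∧ slice Poincaré ∧ route Π's two `k`-free lines ∧ (PG) ∧ row NE3's `hleaves` ⟹ (8)∃.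
WHAT REMAINS ASSERTED FOR NOTHING: (PG), `hleaves`, `LevelSmall`, the slice Poincaré inequality, the two lines.  HONEST FRAMING (page 1): nothing of Bałaban's
asserted as an axiom; NE7 NOT PROVED unconditionally; spine 0∕9; finite T⁴ rung (B)+1 — NOT infinite volume, NOT mass gap, NOT `BetaPertH`, NOT Clay.  Continuum YM
on T⁴ ⇐ BetaPertH ∧ nine spine estimates (0/9 proved); BetaPertH ⇐ (D1) ∧ (D4) ∧ CAP+tail; G-an2-4 gates asym, D1 and NE2/3/4.  No `sorry`; axioms ⊆ {propext,
Classical.choice, Quot.sound}.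
-/

set_option autoImplicit false

open scoped BigOperators Matrix Matrix.Norms.L2Operator Topology
open NormedSpace Finset Set Filter

namespace Summit.QuantumFields.BalabanUV.T4Continuum.NE7HintOfPlaqGrad

open Literature.MathematicalPhysics.QuantumFieldTheory.Balaban1983to89
open B7Prop1Explicit B7Prop2Explicit MatrixLog UnitaryModel
open B4TorusKernel.MultiPeriod (torusSupNorm)
open T4AveragingDeficitWall (Ad IsUnitaryCfg IsSkewDir SmallField vary curl curlSq dirSq dirL1)
open T4AveragingDeficitWallBoundary (IsPeriodicCfg periodBox)
open AveragingDeficitPeriodicCounting (IsPeriodicDir)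
open AveragingDeficitMultiLevelPrep (LevelSmall tower TangentIter)
open BlockAverageVaryHolo (nbRad)
open MinimalActionLevels (perWin)
open MinimalActionSandwich (IsMinimiser admissible)
open MinimalActionRate (sfClass)
open NE3HessForm (dAction)
open NE3SlicePoincareShape (SlicePoincare)
open NE3FrameFreeSliceW (frameFreeBlockLandauW)
open NE3TangentCovariantTower (dirIter)
open NE3DecomposedRepOfLinearNormalPart (ResidualSliceRepT)
open NE3QbarIterCovLiftPrep (cruxC)
open NE3SmoothRightInverseW (rightInvW)
open NE3RightInverseSolveLetters (thetaLoc)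
open NE3RightInverseL2Letter (l2C)
open NE3HatInvCurlLetters (curl2C curl1C)
open NE3EnergyShapes (IsUnitarySite)
open BlockAveragePushDirSplit (flat)
open NE7HintOfLocalChartWide (hint_of_localChart_wide)
open NE7AxialChartTorus (exists_periodic_chart)

noncomputable section

variable {d : ℕ} {n : Type*} [Fintype n] [DecidableEq n]

/-! ## §1 Closed-form arithmetic of the chart constants -/

/-- The sup letter: `M·(4(dd+1)(R_r + 1)·r∕M²) ≤ 4(dd+1)Λ·T` for `R_r + 1 ≤ Λ M`, `M ≥ 1`, `0 ≤ r ≤ T`. [folklore] -/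
theorem sup_const_bound {M r T dd Rr Λ : ℝ} (hdd : 0 ≤ dd) (hM : 1 ≤ M) (hΛ : 0 ≤ Λ) (hRr0 : 0 ≤ Rr) (hRr : Rr + 1 ≤ Λ * M)
    (hr0 : 0 ≤ r) (hrT : r ≤ T) :
    M * (4 * (dd + 1) * (Rr + 1) * (r / M ^ 2)) ≤ 4 * (dd + 1) * Λ * T := by
  have hM0 : 0 < M := by linarith
  have h1 : M * (4 * (dd + 1) * (Rr + 1) * (r / M ^ 2)) = 4 * (dd + 1) * ((Rr + 1) / M) * r := by
    field_simp
    try ring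
  have h2 : (Rr + 1) / M ≤ Λ := by rw [div_le_iff₀ hM0]; linarith
  have h20 : 0 ≤ (Rr + 1) / M := by positivity
  rw [h1]
  have h3 : 4 * (dd + 1) * ((Rr + 1) / M) * r ≤ 4 * (dd + 1) * Λ * r := by
    have := mul_le_mul_of_nonneg_right h2 hr0
    nlinarith
  have h4 : 4 * (dd + 1) * Λ * r ≤ 4 * (dd + 1) * Λ * T := by
    have : 0 ≤ 4 * (dd + 1) * Λ := by positivity
    nlinarith
  linarith

/-- The gradient letter: `M²·a₁ ≤ [(4∕3)(2(dd+1)ΛC_g + 16(dd+1)²Λ² + 2) + 4(dd+1)Λ]·T` with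
`a₁ = (4∕3)(2(dd+1)(R_r+2)·x₁ + 16(dd+1)²(R_r+2)²·x² + 2x) + 4(dd+1)(R_r+1)x∕M`, `x = r∕M²`, `x₁ = C_g T∕M³`, for `R_r + 2 ≤ ΛM`, `M ≥ 1`,
`0 ≤ r ≤ T`, `r ≤ 1`. [folklore] -/
theorem grad_const_bound {M r T Cg dd Rr Λ : ℝ} (hdd : 0 ≤ dd) (hM : 1 ≤ M) (hΛ : 0 ≤ Λ) (hCg : 0 ≤ Cg) (hRr0 : 0 ≤ Rr)
    (hRr : Rr + 2 ≤ Λ * M) (hr0 : 0 ≤ r) (hrT : r ≤ T) (hr1 : r ≤ 1) :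
    M ^ 2 * (4 / 3 * (2 * (dd + 1) * (Rr + 2) * (Cg * T / M ^ 3) + 16 * (dd + 1) ^ 2 * (Rr + 2) ^ 2 * (r / M ^ 2) ^ 2 + 2 * (r / M ^ 2))
        + 4 * (dd + 1) * (Rr + 1) * (r / M ^ 2) / M)
      ≤ (4 / 3 * (2 * (dd + 1) * Λ * Cg + 16 * (dd + 1) ^ 2 * Λ ^ 2 + 2) + 4 * (dd + 1) * Λ) * T := by
  have hM0 : 0 < M := by linarith
  have hT0 : 0 ≤ T := hr0.trans hrT
  have hq1 : (Rr + 2) / M ≤ Λ := by rw [div_le_iff₀ hM0]; linarith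
  have hq2 : (Rr + 1) / M ≤ Λ := by rw [div_le_iff₀ hM0]; linarith
  have hq10 : 0 ≤ (Rr + 2) / M := by positivity
  have hq20 : 0 ≤ (Rr + 1) / M := by positivity
  have hsplit : M ^ 2 * (4 / 3 * (2 * (dd + 1) * (Rr + 2) * (Cg * T / M ^ 3) + 16 * (dd + 1) ^ 2 * (Rr + 2) ^ 2 * (r / M ^ 2) ^ 2 + 2 * (r / M ^ 2))
        + 4 * (dd + 1) * (Rr + 1) * (r / M ^ 2) / M)
      = 4 / 3 * (2 * (dd + 1) * ((Rr + 2) / M) * (Cg * T)) + 4 / 3 * (16 * (dd + 1) ^ 2 * ((Rr + 2) / M) ^ 2 * r ^ 2) + 8 / 3 * r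
        + 4 * (dd + 1) * ((Rr + 1) / M) * r := by
    field_simp
    try ring
  rw [hsplit]
  have hd1 : 0 ≤ dd + 1 := by linarith
  have t1 : 2 * (dd + 1) * ((Rr + 2) / M) * (Cg * T) ≤ 2 * (dd + 1) * Λ * Cg * T := by
    have := mul_le_mul_of_nonneg_right hq1 (mul_nonneg hCg hT0)
    nlinarith [mul_nonneg hd1 (mul_nonneg hCg hT0)]
  have t2 : 16 * (dd + 1) ^ 2 * ((Rr + 2) / M) ^ 2 * r ^ 2 ≤ 16 * (dd + 1) ^ 2 * Λ ^ 2 * T := by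
    have hsq : ((Rr + 2) / M) ^ 2 ≤ Λ ^ 2 := pow_le_pow_left₀ hq10 hq1 2
    have hr2 : r ^ 2 ≤ T := by nlinarith
    have := mul_le_mul hsq hr2 (sq_nonneg r) (by positivity)
    have h16 : 0 ≤ 16 * (dd + 1) ^ 2 := by positivity
    nlinarith [mul_le_mul_of_nonneg_left this h16]
  have t3 : 8 / 3 * r ≤ 8 / 3 * T := by linarith
  have t4 : 4 * (dd + 1) * ((Rr + 1) / M) * r ≤ 4 * (dd + 1) * Λ * T := by
    have := mul_le_mul hq2 hrT hr0 hΛ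
    nlinarith [mul_le_mul_of_nonneg_left this hd1]
  nlinarith

/-! ## §2 THE CHART from the plaquette-gradient datum (PG) -/

set_option maxHeartbeats 800000 in
/-- **THE CHART OF ROW NE7 FROM (PG), every `d + 1`, `L ≥ 2`.**  For `ℓ`, `N ≥ 1`, a cover factor `Kc ≥ 2·nbRad (d+1) L + 4ℓ + 24`, `0 ≤ ε ≤ 1∕(4(d+1)Λ)`
(`Λ = nbRad (d+1) L + 2ℓ + 12`), `β ≥ 0`, `C_g ≥ 0`: IF every tangent-critical admissible `U` of the class (period `N·Kc·L^{k+1}`) with `SmallField U (r∕M²)`,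
`0 ≤ r ≤ ε∕L²`, has covariant plaquette gradients `≤ C_g(r + 4(e^β−1) + ε)∕M³` in every direction (PG), THEN the `hchart` binder of F285w holds with
`C₀ = 4(d+1)Λ` and `C₁ = (4∕3)(2(d+1)ΛC_g + 16(d+1)²Λ² + 2) + 4(d+1)Λ` (F290b `NE7AxialChartTorus.exists_periodic_chart` on the cube of radius
`(nbRad + 2ℓ + 11)M`, collar `M`). [folklore] -/
theorem chart_of_plaqGrad [Nonempty n] {L : ℕ} [NeZero L] (hL : 2 ≤ L) (ℓ : ℕ) {N : ℕ} [NeZero N] (hN : 1 ≤ N) {Kc : ℕ}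
    (hKc : 2 * nbRad (d + 1) L + 4 * ℓ + 24 ≤ Kc) {ε β Cg : ℝ} (hε0 : 0 ≤ ε)
    (hεℓ : ε ≤ 1 / (4 * (((d + 1 : ℕ) : ℝ)) * ((nbRad (d + 1) L : ℝ) + 2 * (ℓ : ℝ) + 12))) (hβ0 : 0 ≤ β) (hCg : 0 ≤ Cg)
    (hPG : (∀ D : Site (d + 1) → Fin (d + 1) → (Matrix n n ℂ)ˣ, IsUnitaryCfg D → IsPeriodicCfg D ((N * Kc) : ℤ) → SmallField D (4 * (Real.exp β - 1)) →
      ∀ (k : ℕ), ∀ U ∈ admissible (sfClass (d + 1) L (N * Kc) ε) L (k + 1) D,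
      (∀ φ : Site (d + 1) → Fin (d + 1) → Matrix n n ℂ, IsSkewDir φ → IsPeriodicDir φ (((N * Kc) * L ^ (k + 1) : ℕ) : ℤ) → TangentIter L k U φ →
        dAction U φ (perWin (d + 1) ((N * Kc) * L ^ (k + 1))) = 0) →
      ∀ r : ℝ, 0 ≤ r → r ≤ (1 / (L : ℝ) ^ 2 * ε) → SmallField U (r / ((L : ℝ) ^ (k + 1)) ^ 2) →
      ∀ (q : Site (d + 1)) (τ μ κ : Fin (d + 1)), κ ≠ μ →
        ‖Ad (U q τ) ((hol U (q + e τ) (plaqWord κ μ) : (Matrix n n ℂ)ˣ) : Matrix n n ℂ) - ((hol U q (plaqWord κ μ) : (Matrix n n ℂ)ˣ) : Matrix n n ℂ)‖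
          ≤ Cg * (r + 4 * (Real.exp β - 1) + ε) / ((L : ℝ) ^ (k + 1)) ^ 3)) :
    (∀ D : Site (d + 1) → Fin (d + 1) → (Matrix n n ℂ)ˣ, IsUnitaryCfg D → IsPeriodicCfg D ((N * Kc) : ℤ) → SmallField D (4 * (Real.exp β - 1)) →
      ∀ (k : ℕ), ∀ U ∈ admissible (sfClass (d + 1) L (N * Kc) ε) L (k + 1) D,
      (∀ φ : Site (d + 1) → Fin (d + 1) → Matrix n n ℂ, IsSkewDir φ → IsPeriodicDir φ (((N * Kc) * L ^ (k + 1) : ℕ) : ℤ) → TangentIter L k U φ →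
        dAction U φ (perWin (d + 1) ((N * Kc) * L ^ (k + 1))) = 0) →
      ∀ r : ℝ, 0 ≤ r → r ≤ (1 / (L : ℝ) ^ 2 * ε) → SmallField U (r / ((L : ℝ) ^ (k + 1)) ^ 2) →
      ∀ z : Site (d + 1), ∃ (u : Site (d + 1) → (Matrix n n ℂ)ˣ) (At : Site (d + 1) → Fin (d + 1) → Matrix n n ℂ) (a₀ a₁ : ℝ),
        IsUnitarySite u ∧ (∀ (y : Site (d + 1)) (i : Fin (d + 1)), u (y + (((N * Kc) * L ^ (k + 1) : ℕ) : ℤ) • e i) = u y) ∧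
        IsSkewDir At ∧ IsPeriodicDir At (((N * Kc) * L ^ (k + 1) : ℕ) : ℤ) ∧ 0 ≤ a₀ ∧ 0 ≤ a₁ ∧
        (∀ (y : Site (d + 1)) (κ : Fin (d + 1)), ‖At y κ‖ ≤ a₀) ∧ (∀ (y : Site (d + 1)) (κ τ : Fin (d + 1)), ‖At (y + e τ) κ - At y κ‖ ≤ a₁) ∧
        (L : ℝ) ^ (k + 1) * a₀ ≤ (4 * (((d + 1 : ℕ) : ℝ)) * ((nbRad (d + 1) L : ℝ) + 2 * (ℓ : ℝ) + 12)) * (r + 4 * (Real.exp β - 1) + ε) ∧ ((L : ℝ) ^ (k + 1)) ^ 2 * a₁ ≤ (4 / 3 * (2 * (((d + 1 : ℕ) : ℝ)) * ((nbRad (d + 1) L : ℝ) + 2 * (ℓ : ℝ) + 12) * Cg + 16 * (((d + 1 : ℕ) : ℝ)) ^ 2 * ((nbRad (d + 1) L : ℝ) + 2 * (ℓ : ℝ) + 12) ^ 2 + 2) + 4 * (((d + 1 : ℕ) : ℝ)) * ((nbRad (d + 1) L : ℝ) + 2 * (ℓ : ℝ) + 12)) * (r + 4 * (Real.exp β - 1)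 + ε) ∧
        (∀ (y : Site (d + 1)) (κ : Fin (d + 1)),
          torusSupNorm (fun _ : Fin (d + 1) => L ^ (k + 1) * (N * Kc)) (y - z) ≤ (((nbRad (d + 1) L + 2 * ℓ + 10) * L ^ (k + 1) : ℕ) : ℝ) →
            gaugeAct u U y κ = vary (flat (d := d + 1) (n := n)) At 1 y κ)) := by
  intro D hDu hDP hDs k U hU hcrit r hr0 hr hUr z
  -- the block size `M = L^{k+1}` (generalised), the radii, the period `N·Kc·M`
  have hL1 : 1 ≤ L := by omega
  have hM2 : 2 ≤ L ^ (k + 1) :=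
    calc 2 ≤ L := hL
      _ = L ^ 1 := (pow_one L).symm
      _ ≤ L ^ (k + 1) := Nat.pow_le_pow_right hL1 (by omega)
  have hMr' : (L : ℝ) ^ (k + 1) = ((L ^ (k + 1) : ℕ) : ℝ) := by rw [Nat.cast_pow]
  have hgrad : ∀ (q : Site (d + 1)) (τ μ κ : Fin (d + 1)), κ ≠ μ →
      ‖Ad (U q τ) ((hol U (q + e τ) (plaqWord κ μ) : (Matrix n n ℂ)ˣ) : Matrix n n ℂ) - ((hol U q (plaqWord κ μ) : (Matrix n n ℂ)ˣ) : Matrix n n ℂ)‖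
        ≤ Cg * (r + 4 * (Real.exp β - 1) + ε) / ((L : ℝ) ^ (k + 1)) ^ 3 :=
    fun q τ μ κ hκ => hPG D hDu hDP hDs k U hU hcrit r hr0 hr hUr q τ μ κ hκ
  clear hPG
  rw [hMr'] at hUr hgrad ⊢
  generalize hMdef : L ^ (k + 1) = M at *
  have hM1 : 1 ≤ M := by omega
  have hMr : (2 : ℝ) ≤ (M : ℝ) := by exact_mod_cast hM2
  have hM0r : (0 : ℝ) < (M : ℝ) := by linarith
  have hM1r : (1 : ℝ) ≤ (M : ℝ) := by linarith
  have hℓ0 : (0 : ℝ) ≤ (ℓ : ℝ) := Nat.cast_nonneg ℓ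
  have hnb0 : (0 : ℝ) ≤ (nbRad (d + 1) L : ℝ) := Nat.cast_nonneg _
  have hd0 : (0 : ℝ) ≤ (d : ℝ) := Nat.cast_nonneg d
  have hL2r : (2 : ℝ) ≤ (L : ℝ) := by exact_mod_cast hL
  -- the class data of `U`
  have hUu : IsUnitaryCfg U := hU.1.1
  have hUP : IsPeriodicCfg U ((N * Kc * M : ℕ) : ℤ) := by rw [← hMdef]; exact hU.1.2.1
  -- the datum `t`
  have hβ' : 0 ≤ 4 * (Real.exp β - 1) := by nlinarith [Real.add_one_le_exp β]
  have hrT : r ≤ r + 4 * (Real.exp β - 1) + ε := by linarith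
  have hT0 : 0 ≤ r + 4 * (Real.exp β - 1) + ε := hr0.trans hrT
  set Λ : ℝ := (nbRad (d + 1) L : ℝ) + 2 * (ℓ : ℝ) + 12 with hΛ
  have hΛ1 : (12 : ℝ) ≤ Λ := by rw [hΛ]; linarith
  have hdd : (((d + 1 : ℕ) : ℝ)) = (d : ℝ) + 1 := by push_cast; ring
  have hε1 : ε ≤ 1 / 4 := by
    refine hεℓ.trans (one_div_le_one_div_of_le (by norm_num) ?_)
    rw [hdd]; nlinarith
  have hrε : r ≤ ε / 4 := by
    refine hr.trans ?_
    have h1 : 1 / (L : ℝ) ^ 2 ≤ 1 / 4 := one_div_le_one_div_of_le (by norm_num) (by nlinarith)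
    have h2 := mul_le_mul_of_nonneg_right h1 hε0
    linarith
  have hr1 : r ≤ 1 := by linarith
  have hx0 : 0 ≤ r / (M : ℝ) ^ 2 := by positivity
  have hx10 : 0 ≤ Cg * (r + 4 * (Real.exp β - 1) + ε) / (M : ℝ) ^ 3 := by positivity
  -- the geometric conditions of F290b
  have hMwR : M ≤ (nbRad (d + 1) L + 2 * ℓ + 11) * M := by nlinarith
  have hPR : 2 * ((nbRad (d + 1) L + 2 * ℓ + 11) * M) + 4 ≤ N * Kc * M := by
    have h1 : 2 * nbRad (d + 1) L + 4 * ℓ + 24 ≤ N * Kc := hKc.trans (Nat.le_mul_of_pos_left _ (by omega))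
    have h2 : (2 * nbRad (d + 1) L + 4 * ℓ + 24) * M ≤ N * Kc * M := Nat.mul_le_mul_right _ h1
    nlinarith
  have hs : 2 * ((d : ℝ) + 1) * ((((nbRad (d + 1) L + 2 * ℓ + 11) * M : ℕ) : ℝ) + 1) * (r / (M : ℝ) ^ 2) ≤ 1 / 4 := by
    have h1 : ((((nbRad (d + 1) L + 2 * ℓ + 11) * M : ℕ) : ℝ) + 1) ≤ Λ * M := by rw [hΛ]; push_cast; nlinarith
    have h2 : 2 * ((d : ℝ) + 1) * ((((nbRad (d + 1) L + 2 * ℓ + 11) * M : ℕ) : ℝ) + 1) * (r / (M : ℝ) ^ 2) ≤ 2 * ((d : ℝ) + 1) * (Λ * M) * (r / (M : ℝ) ^ 2) := by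
      have : 0 ≤ 2 * ((d : ℝ) + 1) * (r / (M : ℝ) ^ 2) := by positivity
      nlinarith
    have h4 : 2 * ((d : ℝ) + 1) * (Λ * M) * (r / (M : ℝ) ^ 2) = 2 * ((d : ℝ) + 1) * Λ * (r / M) := by field_simp; try ring
    have h5 : r / (M : ℝ) ≤ r := by rw [div_le_iff₀ hM0r]; nlinarith
    have h6 : ((d : ℝ) + 1) * Λ * ε ≤ 1 / 4 := by
      have h7 := hεℓ
      rw [hdd, le_div_iff₀ (by positivity)] at h7
      nlinarith
    have h8 : 0 ≤ 2 * ((d : ℝ) + 1) * Λ := by positivity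
    have h9 := mul_le_mul_of_nonneg_left (h5.trans hrε) h8
    linarith
  -- F290b
  obtain ⟨u, At, huU, huP, hAs, hAP, hsup, hgr, hagree⟩ :=
    exists_periodic_chart (d := d) (n := n) hUu hUP hx0 hx10 hUr hgrad z ((nbRad (d + 1) L + 2 * ℓ + 11) * M) M hM1 hMwR hPR hs
  refine ⟨u, At, _, _, huU, huP, hAs, hAP, ?_, ?_, hsup, hgr, ?_, ?_, ?_⟩
  · positivity
  · positivity
  · -- `M·a₀ ≤ C₀·t`
    have e1 : ((((nbRad (d + 1) L + 2 * ℓ + 11) * M : ℕ) : ℝ)) = (Λ - 1) * M := by rw [hΛ]; push_cast; ring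
    rw [e1, hdd]
    have h := sup_const_bound (M := (M : ℝ)) (T := r + 4 * (Real.exp β - 1) + ε) (dd := (d : ℝ)) (Rr := (Λ - 1) * M) (Λ := Λ)
      hd0 hM1r (by linarith) (by nlinarith) (by nlinarith) hr0 hrT
    refine h.trans (le_of_eq ?_)
    ring
  · -- `M²·a₁ ≤ C₁·t`
    have e1 : ((((nbRad (d + 1) L + 2 * ℓ + 11) * M : ℕ) : ℝ)) = (Λ - 1) * M := by rw [hΛ]; push_cast; ring
    rw [e1, hdd]
    have h := grad_const_bound (M := (M : ℝ)) (T := r + 4 * (Real.exp β - 1) + ε) (Cg := Cg) (dd := (d : ℝ)) (Rr := (Λ - 1) * M) (Λ := Λ)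
      hd0 hM1r (by linarith) hCg (by nlinarith) (by nlinarith) hr0 hrT hr1
    refine h.trans (le_of_eq ?_)
    ring
  · -- agreement on the ball of radius `(nbRad (d+1) L + 2ℓ + 10)·M`
    intro y κ hy
    apply hagree y κ
    have e2 : (nbRad (d + 1) L + 2 * ℓ + 11) * M - M = (nbRad (d + 1) L + 2 * ℓ + 10) * M := by
      apply Nat.sub_eq_of_eq_add
      ring
    rw [e2]
    convert hy using 2
    funext i
    ring

/-- The chart constants are polynomial in `ℓ + 1` (clean-context arithmetic for §3): with `Λ = nb + 2ℓ + 12`, `Λ₀ = nb + 12`,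
`A = (4∕3)(2DΛ₀C_g + 16D²Λ₀² + 2) + 4DΛ₀`: `0 ≤ 4DΛ ≤ A(ℓ+1)²` and `0 ≤ (4∕3)(2DΛC_g + 16D²Λ² + 2) + 4DΛ ≤ A(ℓ+1)²`. [folklore] -/
theorem consts_poly_bound (D nb ℓr Cg : ℝ) (hD : 0 ≤ D) (hnb : 0 ≤ nb) (hℓ : 1 ≤ ℓr) (hCg : 0 ≤ Cg) :
    0 ≤ 4 * D * (nb + 2 * ℓr + 12) ∧
    4 * D * (nb + 2 * ℓr + 12) ≤ (4 / 3 * (2 * D * (nb + 12) * Cg + 16 * D ^ 2 * (nb + 12) ^ 2 + 2) + 4 * D * (nb + 12)) * (ℓr + 1) ^ 2 ∧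
    0 ≤ 4 / 3 * (2 * D * (nb + 2 * ℓr + 12) * Cg + 16 * D ^ 2 * (nb + 2 * ℓr + 12) ^ 2 + 2) + 4 * D * (nb + 2 * ℓr + 12) ∧
    4 / 3 * (2 * D * (nb + 2 * ℓr + 12) * Cg + 16 * D ^ 2 * (nb + 2 * ℓr + 12) ^ 2 + 2) + 4 * D * (nb + 2 * ℓr + 12)
      ≤ (4 / 3 * (2 * D * (nb + 12) * Cg + 16 * D ^ 2 * (nb + 12) ^ 2 + 2) + 4 * D * (nb + 12)) * (ℓr + 1) ^ 2 := by
  have hΛle : nb + 2 * ℓr + 12 ≤ (nb + 12) * (ℓr + 1) := by nlinarith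
  have hΛp : 0 ≤ nb + 2 * ℓr + 12 := by linarith
  have hΛ0p : 0 ≤ nb + 12 := by linarith
  have hsq1 : (1 : ℝ) ≤ (ℓr + 1) ^ 2 := by nlinarith
  have hsq2 : ℓr + 1 ≤ (ℓr + 1) ^ 2 := by nlinarith
  have hΛle2 : nb + 2 * ℓr + 12 ≤ (nb + 12) * (ℓr + 1) ^ 2 := hΛle.trans (by nlinarith)
  have hΛsq : (nb + 2 * ℓr + 12) ^ 2 ≤ (nb + 12) ^ 2 * (ℓr + 1) ^ 2 := by
    have := pow_le_pow_left₀ hΛp hΛle 2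
    nlinarith
  have p1 : 2 * D * (nb + 2 * ℓr + 12) * Cg ≤ 2 * D * (nb + 12) * Cg * (ℓr + 1) ^ 2 := by
    have := mul_le_mul_of_nonneg_left hΛle2 (by positivity : (0 : ℝ) ≤ 2 * D * Cg)
    nlinarith
  have p2 : 16 * D ^ 2 * (nb + 2 * ℓr + 12) ^ 2 ≤ 16 * D ^ 2 * (nb + 12) ^ 2 * (ℓr + 1) ^ 2 := by
    have := mul_le_mul_of_nonneg_left hΛsq (by positivity : (0 : ℝ) ≤ 16 * D ^ 2)
    nlinarith
  have p3 : (2 : ℝ) ≤ 2 * (ℓr + 1) ^ 2 := by nlinarith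
  have p4 : 4 * D * (nb + 2 * ℓr + 12) ≤ 4 * D * (nb + 12) * (ℓr + 1) ^ 2 := by
    have := mul_le_mul_of_nonneg_left hΛle2 (by positivity : (0 : ℝ) ≤ 4 * D)
    nlinarith
  have q0 : 0 ≤ 4 / 3 * (2 * D * (nb + 12) * Cg + 16 * D ^ 2 * (nb + 12) ^ 2 + 2) * (ℓr + 1) ^ 2 := by positivity
  refine ⟨by positivity, ?_, by positivity, ?_⟩
  · nlinarith
  · nlinarith

/-! ## §3 (8)∃ from (PG): THE CHART discharged, every `d + 1`, `L ≥ 2` -/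

set_option maxHeartbeats 800000 in
/-- **F292 — (8)∃ FROM THE PLAQUETTE-GRADIENT DATUM (PG), every dimension `d + 1` and block factor `L ≥ 2`.**  [Balaban1985Variational] Thm 1 (8) ∘ Prop 8 ∘
(9)–(10) TYPE, rows NE7 ∘ NE3: for every `C_g ≥ 0` there are `ℓ ≥ 1`, `ε₀ > 0` and, for every `0 < ε ≤ ε₀`, a `β₀ > 0` such that for `0 < β ≤ β₀` and every
period `N ≥ 1`: IF `LevelSmall`, the slice Poincaré inequality, route Π's two `k`-free lines, the PLAQUETTE-GRADIENT DATUM (PG) with constant `C_g` for the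
tangent-critical admissible configurations on the `(2·nbRad (d+1) L + 4ℓ + 24)`-fold cover (small field `r ≤ ε∕L²`), and row NE3's `hleaves` (at
`δ₁ = ε∕(2L²)`) hold, THEN for some `δ_V > 0`, over `{V | unitary, N-periodic, SmallField V δ_V}`, at every level some constrained minimiser over
`sfClass (d+1) L N ε` is `SmallField U a` with `0 ≤ a < ε∕(L^k)²`.  THE CHART is no longer a hypothesis; NE7 is NOT proved unconditionally. -/
theorem hint_of_plaqGrad [Nonempty n] {L : ℕ} [NeZero L] (hL : 2 ≤ L) {Cg : ℝ} (hCg : 0 ≤ Cg) :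
    ∃ ℓ : ℕ, 1 ≤ ℓ ∧ ∃ ε₀ : ℝ, 0 < ε₀ ∧ ∀ ε : ℝ, 0 < ε → ε ≤ ε₀ → ∃ β₀ : ℝ, 0 < β₀ ∧ ∀ β : ℝ, 0 < β → β ≤ β₀ →
    ∀ (N : ℕ) [NeZero N] (CP C₂ αh Ch νh κh : ℝ), 1 ≤ N → 0 < CP →
    (∀ k : ℕ, LevelSmall (d + 1) L k (ε / ((L : ℝ) ^ (k + 1)) ^ 2)) →
    (∀ (j : ℕ) (W' : Site (d + 1) → Fin (d + 1) → (Matrix n n ℂ)ˣ), W' ∈ sfClass (d + 1) L N ε (j + 1) → SlicePoincare L (j + 1) W' (frameFreeBlockLandauW L N (j + 1) W') CP (periodBox (d := d + 1) (N * L ^ (j + 1)))) →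
    0 ≤ C₂ → 0 ≤ αh → αh ≤ 1 → 0 ≤ Ch →
    νh = 2 * Real.sqrt (l2C (d + 1) L / (1 - thetaLoc (d + 1) L * ε) ^ 2 + curl2C (d + 1) L / (1 - thetaLoc (d + 1) L * ε) ^ 2) * C₂ * Ch * αh →
    κh = 4 * (curl1C (d + 1) L / (1 - thetaLoc (d + 1) L * ε)) * C₂ * Ch ^ 2 * ε →
    νh < 1 →
    2 * (κh / (1 - νh) ^ 2) < ((((1 / 2 - (νh / (1 - νh)) ^ 2) / (2 * (1 + CP)) - (νh / (1 - νh)) ^ 2) / 2 - 576 * ((d + 1 : ℕ) : ℝ) * (αh ^ 2 * Real.exp (2 * αh))) / (Fintype.card n : ℝ) - 28 * ((d + 1 : ℕ) : ℝ) * (ε + 7 * αh ^ 2)) →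
    -- (PG): the covariant plaquette-gradient radius of the tangent-critical admissible configurations on the `(2·nbRad + 4ℓ + 24)`-fold cover
    (∀ D : Site (d + 1) → Fin (d + 1) → (Matrix n n ℂ)ˣ, IsUnitaryCfg D → IsPeriodicCfg D ((N * (2 * nbRad (d + 1) L + 4 * ℓ + 24)) : ℤ) → SmallField D (4 * (Real.exp β - 1)) →
      ∀ (k : ℕ), ∀ U ∈ admissible (sfClass (d + 1) L (N * (2 * nbRad (d + 1) L + 4 * ℓ + 24)) ε) L (k + 1) D,
      (∀ φ : Site (d + 1) → Fin (d + 1) → Matrix n n ℂ, IsSkewDir φ → IsPeriodicDir φ (((N * (2 * nbRad (d + 1) L + 4 * ℓ + 24)) * L ^ (k + 1) : ℕ) : ℤ) → TangentIter L k U φ →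
        dAction U φ (perWin (d + 1) ((N * (2 * nbRad (d + 1) L + 4 * ℓ + 24)) * L ^ (k + 1))) = 0) →
      ∀ r : ℝ, 0 ≤ r → r ≤ (1 / (L : ℝ) ^ 2 * ε) → SmallField U (r / ((L : ℝ) ^ (k + 1)) ^ 2) →
      ∀ (q : Site (d + 1)) (τ μ κ : Fin (d + 1)), κ ≠ μ →
        ‖Ad (U q τ) ((hol U (q + e τ) (plaqWord κ μ) : (Matrix n n ℂ)ˣ) : Matrix n n ℂ) - ((hol U q (plaqWord κ μ) : (Matrix n n ℂ)ˣ) : Matrix n n ℂ)‖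
          ≤ Cg * (r + 4 * (Real.exp β - 1) + ε) / ((L : ℝ) ^ (k + 1)) ^ 3) →
    -- ROW NE3's PER-PAIR BINDER on the data class at `δ₁ = λε/2` (F31's `hleaves`, dimension `d + 1`)
    (∀ D : Site (d + 1) → Fin (d + 1) → (Matrix n n ℂ)ˣ, IsUnitaryCfg D → IsPeriodicCfg D (N : ℤ) → SmallField D (4 * (Real.exp β - 1)) → ∀ (k : ℕ), ∀ Us ∈ admissible (sfClass (d + 1) L N ε) L (k + 1) D, SmallField Us ((1 / (L : ℝ) ^ 2 * ε / 2) / ((L : ℝ) ^ (k + 1)) ^ 2) → (∀ φ : Site (d + 1) → Fin (d + 1) → Matrix n n ℂ, IsSkewDir φ → IsPeriodicDir φ ((N * L ^ (k + 1) : ℕ) : ℤ) → TangentIter L k Us φ → dAction Us φ (perWin (d + 1) (N * L ^ (k + 1))) = 0) → ∀ U' ∈ admissible (sfClass (d + 1) L N ε) L (k + 1) D, ∃ (u : Site (d + 1) → (Matrix n n ℂ)ˣ) (X₀ : Site (d + 1) → Fin (d + 1) → Matrix n n ℂ) (α₀ : ℝ) (m : Site (d + 1) → Fin (d + 1) → ℝ)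 (C : ℝ), IsSkewDir X₀ ∧ (∀ (hWu : IsUnitaryCfg Us) (hx : 0 ≤ ε / ((L : ℝ) ^ (k + 1)) ^ 2) (hs : LevelSmall (d + 1) L k (ε / ((L : ℝ) ^ (k + 1)) ^ 2)) (hWx : SmallField Us (ε / ((L : ℝ) ^ (k + 1)) ^ 2)) (hθ : cruxC (d + 1) L * (((L : ℝ) ^ (k + 1)) ^ 2 * (ε / ((L : ℝ) ^ (k + 1)) ^ 2)) < 1) (hφ : IsSkewDir (dirIter L (k + 1) Us X₀)), ResidualSliceRepT L N (k + 1) Us U' u X₀ (rightInvW hL k hWu hx hs hWx N hθ hφ) α₀) ∧ (∀ z κ, 0 ≤ m z κ) ∧ 0 ≤ C ∧ ((L : ℝ) ^ (k + 1)) ^ (d + 1) * ∑ z ∈ periodBox (d := d + 1) N, ∑ κ : Fin (d + 1), m z κ ^ 2 ≤ C ^ 2 * dirSq X₀ (periodBox (d := d + 1) (N * L ^ (k + 1))) ∧ (∀ z ∈ periodBox (d := d + 1) N, ∀ κ : Fin (d + 1), ‖dirIter L (k + 1) Us X₀ z κ‖ ≤ C₂ * ((L : ℝ) ^ (k + 1)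 * m z κ) ^ 2) ∧ α₀ * (L : ℝ) ^ (k + 1) ≤ αh ∧ (∀ z κ, m z κ * (L : ℝ) ^ (k + 1) ≤ αh) ∧ C ≤ Ch) →
    ∃ δV : ℝ, 0 < δV ∧
      ∀ V ∈ {V : Site (d + 1) → Fin (d + 1) → (Matrix n n ℂ)ˣ | IsUnitaryCfg V ∧ IsPeriodicCfg V (N : ℤ) ∧ SmallField V δV},
      ∀ k : ℕ, ∃ U : Site (d + 1) → Fin (d + 1) → (Matrix n n ℂ)ˣ, IsMinimiser (d + 1) (sfClass (d + 1) L N ε) L N k V U ∧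
        ∃ a : ℝ, 0 ≤ a ∧ a < ε / ((L : ℝ) ^ k) ^ 2 ∧ SmallField U a := by
  -- the polynomial growth law of the chart constants: `Λ ≤ (nbRad + 12)(ℓ + 1)`
  have hA0 : 0 ≤ (4 / 3 * (2 * (((d + 1 : ℕ) : ℝ)) * ((nbRad (d + 1) L : ℝ) + 12) * Cg + 16 * (((d + 1 : ℕ) : ℝ)) ^ 2 * ((nbRad (d + 1) L : ℝ) + 12) ^ 2 + 2) + 4 * (((d + 1 : ℕ) : ℝ)) * ((nbRad (d + 1) L : ℝ) + 12)) := by positivity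
  obtain ⟨ℓ, hℓ1, ε₀, hε₀, H⟩ := hint_of_localChart_wide (d := d) (n := n) hL hA0 2
  have hεc : (0 : ℝ) < 1 / (4 * (((d + 1 : ℕ) : ℝ)) * ((nbRad (d + 1) L : ℝ) + 2 * (ℓ : ℝ) + 12)) := by positivity
  refine ⟨ℓ, hℓ1, min ε₀ (1 / (4 * (((d + 1 : ℕ) : ℝ)) * ((nbRad (d + 1) L : ℝ) + 2 * (ℓ : ℝ) + 12))), lt_min hε₀ hεc, fun ε hε hεle => ?_⟩
  obtain ⟨β₀, hβ₀, H2⟩ := H ε hε (hεle.trans (min_le_left _ _))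
  refine ⟨β₀, hβ₀, ?_⟩
  intro β hβ hβle N _ CP C₂ αh Ch νh κh hN hCP hls hP hC₂ hαh0 hαh1 hCh0 hνh hκh hν hline hPG hleaves
  -- the constants are `≤ A(ℓ+1)²` (clean-context arithmetic)
  have hℓr : (1 : ℝ) ≤ (ℓ : ℝ) := by exact_mod_cast hℓ1
  obtain ⟨hC₀, hC₀b, hC₁, hC₁b⟩ := consts_poly_bound (((d + 1 : ℕ) : ℝ)) (nbRad (d + 1) L : ℝ) (ℓ : ℝ) Cg (Nat.cast_nonneg _) (Nat.cast_nonneg _) hℓr hCg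
  have hchart := chart_of_plaqGrad (d := d) (n := n) hL ℓ hN (Kc := 2 * nbRad (d + 1) L + 4 * ℓ + 24) le_rfl hε.le
    (hεle.trans (min_le_right _ _)) hβ.le hCg hPG
  exact H2 β hβ hβle N (2 * nbRad (d + 1) L + 4 * ℓ + 24) CP (4 * (((d + 1 : ℕ) : ℝ)) * ((nbRad (d + 1) L : ℝ) + 2 * (ℓ : ℝ) + 12))
    (4 / 3 * (2 * (((d + 1 : ℕ) : ℝ)) * ((nbRad (d + 1) L : ℝ) + 2 * (ℓ : ℝ) + 12) * Cg + 16 * (((d + 1 : ℕ) : ℝ)) ^ 2 * ((nbRad (d + 1) L : ℝ) + 2 * (ℓ : ℝ) + 12) ^ 2 + 2) + 4 * (((d + 1 : ℕ) : ℝ)) * ((nbRad (d + 1) L : ℝ) + 2 * (ℓ : ℝ) + 12))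
    C₂ αh Ch νh κh hN (by omega) hCP hls hP hC₂ hαh0 hαh1 hCh0 hνh hκh hν hline hC₀ hC₀b hC₁ hC₁b hchart hleaves

end

end Summit.QuantumFields.BalabanUV.T4Continuum.NE7HintOfPlaqGrad
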